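import Summits.CriticalPhenomena.PercolationContinuityZ3.Theorems.PercAnnulusCrossingIICMeanDegree
import HarnessLib

/-!
# THE FINITE BUSHES AT THE ROOT AND THE CUT VERTICES OF THE IIC: a mass-transport duality (lane RSW3, p1 gen 11)

builds on p205010 (kernel theorem, internal audit signed; external expert review pending) — not used (every `p` with `θ(p) = 0` and
(A2)□ at aspect `(s, L)`, `2 ≤ s`; the `p_c` / `ℤ²` specialisations are left to the reader of `…IICMassTransport`).

Seat `prim-rsw3-p1` (gen 11); memo `run/shared/lean/prim/rsw3/P1-QM.md` §24.  Helper file; no definitions, no sorries.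

Say that `x` CUTS `y` OFF (from infinity) if `y ∈ C(x)`, `y ≠ x`, and `y` does not percolate in `ω ∖ E(x)` (`E(x)` = the edges at `x`):
`y` lies in a finite piece of `C(x) ∖ {x}` — equivalently `x` is a cut vertex of the cluster separating `y` from infinity.  The transport
`f(x, y, ω) = 1{x cuts y off}` is diagonally invariant (`cutOff_relabel_shift_iff`) and measurable (`measurableSet_cutOff`), so gen 10's
mass-transport principle gives

* **`iicMeasure_tsum_cutOff_eq_tsum_cutVertex`** — `θ(p) = 0`, (A2)□ at `(s,L)` (`2 ≤ s`), `ν` an IIC probability measure (`0 < p`, `d ≥ 1`):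
  **`Σ_y ν(0 cuts y off) = Σ_y ν(y cuts 0 off)`**, i.e. **`E_ν |{vertices of the IIC in the finite bushes hanging at the root}| =
  E_ν |{cut vertices of the IIC separating the root from infinity}|`** in `[0, ∞]`;
* `openCluster_sdiff_setOf_mem_eq_of_notMem` (closing the edges at a site outside `C(x)` leaves `C(x)` unchanged) and
  **`iicMeasure_tsum_cutOff_eq_tsum_pivotal`** — since the root percolates `ν`-a.s., the right side equals
  `Σ_{y ≠ 0} ν(0 ↛ ∞ in ω ∖ E(y))`, the mean number of PIVOTAL SITES for the root's connection to infinity.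

(Whether either side is finite is not decided here; in the plane both are presumably infinite — pivotal sites at distance `r` have
density `≈ r^{-5/4}` against the IIC normalisation.)  Companion of `…IICMeanDegree` (`E #neighbours screened by the root = ν(root screened)`).
References: D. Aldous, R. Lyons, EJP 12 (2007) §2; H. Kesten, PTRF 73 (1986) Thm. (3); D. Basu, A. Sapozhnikov, ECP 22 (2017) no. 26.
-/

noncomputable section

namespace Summit.CriticalPhenomena.PercolationContinuityZ3.Theorems.Crossing

open MeasureTheory Filter Topology Literature.Probability.Percolation Literature.Probability.LatticeModels
open Literature.Probability.Percolation.DCT16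
open Summit.CriticalPhenomena.PercolationContinuityZ3.Theorems.SurfaceTension
open scoped Literature.Probability.Percolation ENNReal

variable {d : ℕ}

/-- `{x ↔ y, y ≠ x, y does not percolate in ω ∖ E(x)}` ("`x` CUTS `y` OFF from infinity") is measurable. [folklore] -/
theorem measurableSet_cutOff (x y : Site d) :
    MeasurableSet {ω : BondConfig (Site d) | ω ∈ openConn x y ∧ y ≠ x ∧ ω \ {e : Sym2 (Site d) | x ∈ e} ∉ percolatesAt y} :=
  (measurableSet_openConn_holds x y).inter
    ((measurableSet_setOf.2 measurable_const).inter ((measurable_sdiff_const _) (measurableSet_percolatesAt_holds y)).compl)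

/-- Cutting off is translation covariant. [folklore] -/
theorem cutOff_relabel_shift_iff (w x y : Site d) (ω : BondConfig (Site d)) :
    (BondConfig.relabel (sym2Equiv (Site.shift w)) ω ∈ openConn (x + w) (y + w) ∧ y + w ≠ x + w ∧
      BondConfig.relabel (sym2Equiv (Site.shift w)) ω \ {e : Sym2 (Site d) | x + w ∈ e} ∉ percolatesAt (y + w)) ↔
    (ω ∈ openConn x y ∧ y ≠ x ∧ ω \ {e : Sym2 (Site d) | x ∈ e} ∉ percolatesAt y) := by
  have hconn : BondConfig.relabel (sym2Equiv (Site.shift w)) ω ∈ openConn (x + w) (y + w) ↔ ω ∈ openConn x y := by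
    have h := reachable_relabel_iff (Site.shift w) ω x y
    rw [Site.shift_apply, Site.shift_apply] at h
    exact h
  have hperc := relabel_mem_percolatesAt_iff (Site.shift w) (ω \ {e : Sym2 (Site d) | x ∈ e}) y
  rw [Site.shift_apply] at hperc
  rw [hconn, relabel_shift_sdiff_setOf_mem, hperc, add_left_injective w |>.ne_iff]

/-- Closing the edges at a vertex OUTSIDE `C(x)` does not change `C(x)`. [folklore] -/
theorem openCluster_sdiff_setOf_mem_eq_of_notMem {V : Type*} (ω : BondConfig V) {x y : V} (hy : y ∉ openCluster ω x) :
    openCluster (ω \ {e : Sym2 V | y ∈ e}) x = openCluster ω x := by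
  refine Set.Subset.antisymm (fun z hz => ?_) (fun z hz => ?_)
  · exact (hz : (openGraph _).Reachable x z).mono (openGraph_mono Set.sdiff_subset)
  · refine mem_of_reachable_of_forall_adj (G := openGraph ω) (D := openCluster (ω \ {e : Sym2 V | y ∈ e}) x) ?_ hz
      (mem_openCluster_self _ _)
    intro a b ha hab
    have hxa : (openGraph (ω \ {e : Sym2 V | y ∈ e})).Reachable x a := ha
    have haC : a ∈ openCluster ω x := hxa.mono (openGraph_mono Set.sdiff_subset)
    have hbC : b ∈ openCluster ω x := (haC : (openGraph ω).Reachable x a).trans hab.reachable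
    have hya : y ≠ a := fun h => hy (h ▸ haC)
    have hyb : y ≠ b := fun h => hy (h ▸ hbC)
    exact hxa.trans ((openGraph_sdiff_setOf_mem_adj ω y a b).2 ⟨hab, hya, hyb⟩).reachable

/-- **THE BUSH / CUT-VERTEX DUALITY FOR KESTEN'S IIC**: `θ(p) = 0`, (A2)□ at aspect `(s,L)` (`2 ≤ s`), `ν` an IIC probability measure at
`p` (`0 < p`, `d ≥ 1`) ⇒
**`Σ_{y ≠ 0} ν(y ∈ C(0), y does not percolate in ω ∖ E(0)) = Σ_{y ≠ 0} ν(y ∈ C(0), 0 does not percolate in ω ∖ E(y))`**, i.e.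
**`E_ν |{vertices of the IIC cut off from infinity by the root}| = E_ν |{cut vertices separating the root from infinity}|`** (in `[0, ∞]`;
`ν`-a.s. `0 ↔ ∞`, so the right side counts the PIVOTAL SITES of the root's connection to infinity): the mean size of the finite
bushes hanging at the root equals the mean number of pivotal sites — mass transport `f(x, y, ω) = 1{x cuts y off}`.
[cite: AldousLyons2007, §2 (MTP)] [cite: BasuSapozhnikov2017ECP, Thm. 1.1 and Remark 2.1] [cite: Kesten1986, Thm. (3)] -/
theorem iicMeasure_tsum_cutOff_eq_tsum_cutVertex (hd : 1 ≤ d) (p : unitInterval) (hp : 0 < (p : ℝ)) (hθ : theta (zdGraph d) 0 p = 0)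
    {s L : ℕ} (hs : 2 ≤ s) {ϰ : ℝ} (hϰ : 0 < ϰ) (hA2 : SetToSetQuasiMultAspectAt d p s L ϰ)
    {ν : Measure (BondConfig (Site d))} [IsProbabilityMeasure ν]
    (hν : ∀ (F : Finset (Sym2 (Site d))) (E : Set (BondConfig (Site d))), MeasurableSet E → DeterminedBy E ↑F →
      Tendsto (fun n : ℕ => (bondPercolation (zdGraph d) p).real (E ∩ siteToBoundary d n) / oneArmProb d p n)
        atTop (𝓝 (ν.real E))) :
    ∑' y : Site d, ν {ω | ω ∈ openConn (0 : Site d) y ∧ y ≠ 0 ∧ ω \ {e : Sym2 (Site d) | (0 : Site d) ∈ e} ∉ percolatesAt y} =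
      ∑' y : Site d, ν {ω | ω ∈ openConn y (0 : Site d) ∧ (0 : Site d) ≠ y ∧ ω \ {e : Sym2 (Site d) | y ∈ e} ∉ percolatesAt (0 : Site d)} := by
  set f : Site d → Site d → BondConfig (Site d) → ℝ≥0∞ := fun x y =>
    {ω : BondConfig (Site d) | ω ∈ openConn x y ∧ y ≠ x ∧ ω \ {e : Sym2 (Site d) | x ∈ e} ∉ percolatesAt y}.indicator 1 with hf
  have hfi : ∀ (x y w : Site d) (ω : BondConfig (Site d)),
      f (x + w) (y + w) (BondConfig.relabel (sym2Equiv (Site.shift w)) ω) = f x y ω := by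
    intro x y w ω
    simp only [hf, Set.indicator, Set.mem_setOf_eq, Pi.one_apply]
    by_cases h : ω ∈ openConn x y ∧ y ≠ x ∧ ω \ {e : Sym2 (Site d) | x ∈ e} ∉ percolatesAt y
    · rw [if_pos h, if_pos ((cutOff_relabel_shift_iff w x y ω).2 h)]
    · rw [if_neg h, if_neg (mt (cutOff_relabel_shift_iff w x y ω).1 h)]
  have hmtp := iicMeasure_mass_transport hd p hp hθ hs hϰ hA2 hν f hfi
  have hL : ∀ y : Site d, ∫⁻ ω in openConn (0 : Site d) y, f 0 y ω ∂ν =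
      ν {ω | ω ∈ openConn (0 : Site d) y ∧ y ≠ 0 ∧ ω \ {e : Sym2 (Site d) | (0 : Site d) ∈ e} ∉ percolatesAt y} := by
    intro y
    rw [hf]
    dsimp only
    rw [lintegral_indicator_one (measurableSet_cutOff 0 y), Measure.restrict_apply (measurableSet_cutOff 0 y), Set.inter_eq_left.2]
    exact fun ω hω => hω.1
  have hR : ∀ y : Site d, ∫⁻ ω in openConn (0 : Site d) y, f y 0 ω ∂ν =
      ν {ω | ω ∈ openConn y (0 : Site d) ∧ (0 : Site d) ≠ y ∧ ω \ {e : Sym2 (Site d) | y ∈ e} ∉ percolatesAt (0 : Site d)} := by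
    intro y
    rw [hf]
    dsimp only
    rw [lintegral_indicator_one (measurableSet_cutOff y 0), Measure.restrict_apply (measurableSet_cutOff y 0), Set.inter_eq_left.2]
    intro ω hω
    have h : (openGraph ω).Reachable y 0 := hω.1
    exact h.symm
  simp_rw [hL, hR] at hmtp
  exact hmtp

/-- **Pivotal-site form**: under the same hypotheses, the right side is the mean number of PIVOTAL SITES of the root:
**`Σ_y ν(0 cuts y off) = Σ_{y ≠ 0} ν(0 does not percolate in ω ∖ E(y))`** — `ν`-a.s. the root percolates, and a site outside `C(0)` cannot be
pivotal (`openCluster_sdiff_setOf_mem_eq_of_notMem`), so `{y cuts 0 off}` and `{y ≠ 0, 0 ↛ ∞ in ω ∖ E(y)}` agree `ν`-a.e.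
[cite: AldousLyons2007, §2 (MTP)] [cite: Kesten1986, Thm. (3)] -/
theorem iicMeasure_tsum_cutOff_eq_tsum_pivotal (hd : 1 ≤ d) (p : unitInterval) (hp : 0 < (p : ℝ)) (hθ : theta (zdGraph d) 0 p = 0)
    {s L : ℕ} (hs : 2 ≤ s) {ϰ : ℝ} (hϰ : 0 < ϰ) (hA2 : SetToSetQuasiMultAspectAt d p s L ϰ)
    {ν : Measure (BondConfig (Site d))} [IsProbabilityMeasure ν]
    (hν : ∀ (F : Finset (Sym2 (Site d))) (E : Set (BondConfig (Site d))), MeasurableSet E → DeterminedBy E ↑F →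
      Tendsto (fun n : ℕ => (bondPercolation (zdGraph d) p).real (E ∩ siteToBoundary d n) / oneArmProb d p n)
        atTop (𝓝 (ν.real E))) :
    ∑' y : Site d, ν {ω | ω ∈ openConn (0 : Site d) y ∧ y ≠ 0 ∧ ω \ {e : Sym2 (Site d) | (0 : Site d) ∈ e} ∉ percolatesAt y} =
      ∑' y : Site d, ν {ω | y ≠ 0 ∧ ω \ {e : Sym2 (Site d) | y ∈ e} ∉ percolatesAt (0 : Site d)} := by
  rw [iicMeasure_tsum_cutOff_eq_tsum_cutVertex hd p hp hθ hs hϰ hA2 hν]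
  refine tsum_congr fun y => measure_congr ?_
  have h0 := iicMeasure_ae_percolatesAt hd p hp hν
  filter_upwards [h0] with ω hω
  refine propext ⟨fun h => ⟨Ne.symm h.2.1, h.2.2⟩, fun h => ⟨?_, Ne.symm h.1, h.2⟩⟩
  -- if `y ∉ C(0)` then closing `E(y)` would not affect `C(0)`, which is infinite
  by_contra hy
  have hy' : y ∉ openCluster ω (0 : Site d) := fun h' => hy ((h' : (openGraph ω).Reachable 0 y).symm)
  apply h.2
  show (openCluster (ω \ {e : Sym2 (Site d) | y ∈ e}) (0 : Site d)).Infinite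
  rw [openCluster_sdiff_setOf_mem_eq_of_notMem ω hy']
  exact hω

end Summit.CriticalPhenomena.PercolationContinuityZ3.Theorems.Crossing

end
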